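import Summits.ResolutionOfSingularities.ResolutionOfSingularities.Theorems.FrobeniusLadderFInjectiveMacaulayficationFHalfRowOfTwoStoreysModel
import Mathlib.AlgebraicGeometry.Morphisms.FiniteType
import HarnessLib

/-!
# (W-TD/W8) the LOCAL SECOND STOREY through a CHART and a COORDINATE CHANGE — adapters for row #8 in its local form ✓ p664558 `fHalfConclusion_of_localSecondStorey`
# (crux `FInjectiveMacaulayfication` stmt-ResolutionOfSingularities-15315, chain w45a; res-L1-w45a-plan-1 RULING R21.34 «ROW #8 ROUTE OF RECORD SWITCHES TO (W8): LOCAL SECOND STOREY,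
# ✓p664558 AS TYPED … assembly: ✓p664558 over (a) stub-2ʼs `storey1_fullCl_off_P(_mul)`, (b) stub-3ʼs `…FDStorey2L1BlowupFull` on Spec k[Y]/(G) at the origin, (c) the coordinate
# iso k[Y0..Y4]/(g₂₇₇) ≃ₐ k[Y₁..Y₅]/(G) + transport along stub-2ʼs open immersion ι»; seat res-L1-w45a-stub-1 g13; GENERIC part)

[OURS · L1 W4.5a] Support file (`--supports stmt-ResolutionOfSingularities-15315 --as helper`); def-free; UNCONDITIONAL; no named fact; NOT a statement of any manuscript.
Nothing of the crux is proved. AI-written (AI review is weaker than expert review).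

* `nonempty_stalkIso_of_chart` — an open immersion `ι : Spec B → X₁`, a ring isomorphism `σ : B ≃ A` and points `P₀ ∈ Spec B`, `Q ∈ Spec A` with `σ⁻¹(Q) = P₀` give
  `𝒪_{X₁, ι P₀} ≅ 𝒪_{Spec A, Q}` (stalk map of `ι`, stalk map of `Spec σ`, `stalkCongr`).
* `isClosed_singleton_of_isOpenImmersion` — for `X₁` locally of finite type over a Jacobson scheme, the image under an open immersion of a closed point is a closed
  point (Mathlib `IsOpenEmbedding.preimage_closedPoints`).
* ★ `localSecondStorey_of_chartModel` — ✓ p664865 `localSecondStorey_of_affineModel` with its local-ring isomorphism produced from (ι, σ): the storey-2 datum of ✓ p664558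
  at `P = ι P₀` from an affine model `affineBlowup I` over `Spec A` FULL at every point, `I ≠ ⊥`, `Q ⊆ √I`.
* ★★ `fHalfConclusion_of_localSecondStorey_affine` — ✓ p664558 with an AFFINE first storey `π₁ = affineBlowup.π (τ * K)` over `Spec A₀` (`v ⊆ √τ`, `v ⊆ √K`): the shape of
  row #8 `f4pos_rowD_twoStorey`.
[cite: GortzWedhorn2020, Prop. 13.91 and (13.19)] [cite: StacksProject, Tag 080B and Tag 01J7] [cite: Temkin2008, Lemma 2.1.1 and Lemma 2.1.4]
-/

-- single-problem summit: the doubled namespace component is forced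
set_option linter.dupNamespace false

noncomputable section

namespace Summit.ResolutionOfSingularities.ResolutionOfSingularities.Theorems.FInjectiveMacaulayfication.FHalfRowOfTwoStoreys

open CategoryTheory CategoryTheory.Limits AlgebraicGeometry TopologicalSpace IsLocalRing
open Literature.AlgebraicGeometry.Resolution
open Summit.ResolutionOfSingularities.ResolutionOfSingularities.Theorems.FInjectiveMacaulayfication
open SliceableCentre GermOfGlobalBlowup

universe u

/-- **The stalk of `X₁` at a chart point through a coordinate change.** `ι : Spec B → X₁` an open immersion, `σ : B ≃+* A`, `P₀ ∈ Spec B`, `Q ∈ Spec A` with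
`σ⁻¹(Q) = P₀`; then `𝒪_{X₁, ι P₀} ≅ 𝒪_{Spec A, Q}`. [folklore; cite: StacksProject, Tag 01J7] -/
theorem nonempty_stalkIso_of_chart {X₁ : Scheme.{0}} {A B : Type} [CommRing A] [CommRing B]
    (ι : Spec (.of B) ⟶ X₁) [IsOpenImmersion ι] (σ : B ≃+* A) (P₀ : Spec (.of B)) (Q : Spec (.of A))
    (hQ : Q.asIdeal.comap σ.toRingHom = P₀.asIdeal) :
    Nonempty (X₁.presheaf.stalk (ι.base P₀) ≅ (Spec (.of A)).presheaf.stalk Q) := by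
  let Φ : Spec (.of A) ⟶ Spec (.of B) := Spec.map σ.toCommRingCatIso.hom
  have hΦ : Φ.base Q = P₀ := by
    apply PrimeSpectrum.ext
    rw [Spec.map_apply, RingEquiv.toCommRingCatIso_hom, CommRingCat.hom_ofHom, PrimeSpectrum.comap_asIdeal]
    exact hQ
  let e₁ : X₁.presheaf.stalk (ι.base P₀) ≅ (Spec (.of B)).presheaf.stalk P₀ := asIso (ι.stalkMap P₀)
  let e₂ : (Spec (.of B)).presheaf.stalk (Φ.base Q) ≅ (Spec (.of A)).presheaf.stalk Q := asIso (Φ.stalkMap Q)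
  let e₃ : (Spec (.of B)).presheaf.stalk P₀ ≅ (Spec (.of B)).presheaf.stalk (Φ.base Q) :=
    (Spec (.of B)).presheaf.stalkCongr (Inseparable.of_eq hΦ.symm)
  exact ⟨e₁ ≪≫ e₃ ≪≫ e₂⟩

/-- **The image of a closed point under an open immersion into a scheme locally of finite type over a Jacobson scheme is a closed point.** [cite: StacksProject, Tag 01TB] -/
theorem isClosed_singleton_of_isOpenImmersion {U X₁ Y : Scheme.{u}} (π₁ : X₁ ⟶ Y) [LocallyOfFiniteType π₁] [JacobsonSpace Y]
    (ι : U ⟶ X₁) [IsOpenImmersion ι] (P₀ : U) (hP₀ : IsClosed ({P₀} : Set U)) : IsClosed ({ι.base P₀} : Set X₁) := by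
  haveI : JacobsonSpace X₁ := LocallyOfFiniteType.jacobsonSpace π₁
  have h := ι.isOpenEmbedding.preimage_closedPoints
  have hmem : P₀ ∈ (fun u : U => ι.base u) ⁻¹' closedPoints X₁ := by
    rw [h]
    exact hP₀
  exact hmem

/-- ★ **The local second-storey datum from an affine model through a chart and a coordinate change**: ✓ `localSecondStorey_of_affineModel` with
`e := 𝒪_{X₁, ι P₀} ≅ 𝒪_{Spec A, Q}` from `nonempty_stalkIso_of_chart`. [cite: GortzWedhorn2020, Prop. 13.91] [cite: StacksProject, Tag 0804 and Tag 01J7] -/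
theorem localSecondStorey_of_chartModel (p : ℕ) {X₁ : Scheme.{0}} {A B : Type} [CommRing A] [IsDomain A] [CommRing B]
    (ι : Spec (.of B) ⟶ X₁) [IsOpenImmersion ι] (σ : B ≃+* A) (P₀ : Spec (.of B)) (Q : Spec (.of A))
    (hQ : Q.asIdeal.comap σ.toRingHom = P₀.asIdeal)
    (I : Ideal A) (hI : I ≠ ⊥) (hIQ : Q.asIdeal ≤ I.radical)
    (hfull : ∀ y : ↥(affineBlowup I), FullCl p ((affineBlowup I).presheaf.stalk y)) :
    ∃ 𝔍 : (Spec (X₁.presheaf.stalk (ι.base P₀))).IdealSheafData, 𝔍 ≠ ⊥ ∧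
      (∀ s ∈ (𝔍.support : Set (Spec (X₁.presheaf.stalk (ι.base P₀)))), s = closedPoint (X₁.presheaf.stalk (ι.base P₀))) ∧
      ∀ (S'' : Scheme.{0}) (g : S'' ⟶ Spec (X₁.presheaf.stalk (ι.base P₀))), IsBlowup g 𝔍 → ∀ s : S'', FullCl p (S''.presheaf.stalk s) := by
  obtain ⟨e⟩ := nonempty_stalkIso_of_chart ι σ P₀ Q hQ
  exact localSecondStorey_of_affineModel p (ι.base P₀) I hI Q hIQ e hfull

/-- ★★ **TWO-STOREY GLUE WITH A LOCAL SECOND STOREY, AFFINE FIRST STOREY** (the shape of row #8): `A₀` a Noetherian domain, `τ, K ≠ ⊥` with `V(τ), V(K) ∋ v` only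
(`v ⊆ √τ`, `v ⊆ √K`), `X₁ = affineBlowup (τ * K)`; a CLOSED point `P ∈ X₁` over `v` carrying a local second-storey datum `𝔍` (≠ ⊥, supported at the closed point, all blowings
up FULL); `X₁` FULL at every other point over a generization of `v`. THEN the F-half's conclusion for every blowing up of `Spec 𝒪_{Spec A₀, v}` along `τ·𝒪`.
[cite: Temkin2008, Lemma 2.1.1 and Lemma 2.1.4] [cite: StacksProject, Tag 080B] [cite: GortzWedhorn2020, (13.19)] -/
theorem fHalfConclusion_of_localSecondStorey_affine (p : ℕ) {A₀ : Type} [CommRing A₀] [IsDomain A₀] [IsNoetherianRing A₀] (τ K : Ideal A₀) (hτ : τ ≠ ⊥) (hK : K ≠ ⊥)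
    (v : Spec (.of A₀)) (hvτ : v.asIdeal ≤ τ.radical) (hvK : v.asIdeal ≤ K.radical)
    (P : ↥(affineBlowup (τ * K))) (hPx : (affineBlowup.π (τ * K)).base P = v) (hP : IsClosed ({P} : Set ↥(affineBlowup (τ * K))))
    (𝔍 : (Spec ((affineBlowup (τ * K)).presheaf.stalk P)).IdealSheafData) (h𝔍 : 𝔍 ≠ ⊥)
    (h𝔍supp : ∀ s ∈ (𝔍.support : Set (Spec ((affineBlowup (τ * K)).presheaf.stalk P))), s = closedPoint ((affineBlowup (τ * K)).presheaf.stalk P))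
    (hfull₂ : ∀ (S'' : Scheme.{0}) (g : S'' ⟶ Spec ((affineBlowup (τ * K)).presheaf.stalk P)), IsBlowup g 𝔍 → ∀ s : S'', FullCl p (S''.presheaf.stalk s))
    (hfull₁ : ∀ x₁ : ↥(affineBlowup (τ * K)), x₁ ≠ P → (affineBlowup.π (τ * K)).base x₁ ⤳ v → FullCl p ((affineBlowup (τ * K)).presheaf.stalk x₁)) :
    ∀ (S' : Scheme.{0}) (g : S' ⟶ Spec ((Spec (.of A₀)).presheaf.stalk v)),
      IsBlowup g ((affineBlowup.idealSheaf τ).comap ((Spec (.of A₀)).fromSpecStalk v)) →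
      ∃ 𝓚 : S'.IdealSheafData, 𝓚 ≠ ⊥ ∧ (∀ s ∈ (𝓚.support : Set S'), g.base s = closedPoint ((Spec (.of A₀)).presheaf.stalk v)) ∧
        ∀ (S'' : Scheme.{0}) (π : S'' ⟶ S'), IsBlowup π 𝓚 → ∀ s : S'', FullCl p (S''.presheaf.stalk s) := by
  have hπ : IsBlowup (affineBlowup.π (τ * K)) (affineBlowup.idealSheaf τ * affineBlowup.idealSheaf K) := by
    rw [← affineBlowup.idealSheaf_mul]
    exact affineBlowup.isBlowup (τ * K)
  have hJ : affineBlowup.idealSheaf τ * affineBlowup.idealSheaf K ≠ ⊥ := by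
    rw [← affineBlowup.idealSheaf_mul]
    exact affineBlowup.idealSheaf_ne_bot (mul_ne_zero hτ hK)
  have hsupp : ∀ (L : Ideal A₀), v.asIdeal ≤ L.radical → ∀ y ∈ ((affineBlowup.idealSheaf L).support : Set (Spec (.of A₀))), y ⤳ v → y = v := by
    intro L hvL y hy hyv
    rw [affineBlowup.support_idealSheaf] at hy
    have hLy : L ≤ y.asIdeal := fun a ha => hy ha
    have h1 : v.asIdeal ≤ y.asIdeal := hvL.trans (y.2.radical_le_iff.mpr hLy)
    have h2 : y.asIdeal ≤ v.asIdeal := (PrimeSpectrum.le_iff_specializes y v).mpr hyv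
    exact PrimeSpectrum.ext (le_antisymm h2 h1)
  exact fHalfConclusion_of_localSecondStorey p v hπ hJ (hsupp τ hvτ) (hsupp K hvK) P hPx hP 𝔍 h𝔍 h𝔍supp hfull₂ hfull₁

end Summit.ResolutionOfSingularities.ResolutionOfSingularities.Theorems.FInjectiveMacaulayfication.FHalfRowOfTwoStoreys

end
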